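import Summits.SmoothPoincare4.SmoothPoincare4.Theorems.EntropyRungConicalGapCompactTestIdentity
import Summits.SmoothPoincare4.SmoothPoincare4.Theorems.EntropyRungConicalGapCompactRicciTestIdentity
import Summits.SmoothPoincare4.SmoothPoincare4.Theorems.EntropyRungConicalGapRampLimit
import Summits.SmoothPoincare4.SmoothPoincare4.Theorems.EntropyRungConicalGapFirstOrderTestIdentity
import HarnessLib

/-!
# Localisation of the line `Sketch` identities to sublevel sets of the potential
(crux `EntropyRung.ConicalGap`, stmt-SmoothPoincare4-16589; lead cycle 5)

On a complete connected normalised 4-d gradient shrinking Ricci soliton `(M, g, f)`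
(`Ric + Hess f = g/2`, `R + |∇f|² = f`, closed `g`-balls compact) the identities of the line —
Wang–Wang's `∫ (f − 2τ) e^{-f/τ} = (1 − τ) ∫ R e^{-f/τ}` and the Ricci moment identity — are
global (`τ`-weighted) integrals. The standing disprover showed that the density gap is made in the
COMPACT CORE (incomplete conical ends of every aperture carry density `≥ 1`), so the line needs
identities LOCALISED to the sublevel sets `{f < t}`. This file derives them, with NO derivative of
the volume profile and NO co-area formula, from the compactly supported test-function identities
(`helper_compactTestIdentity`, `helper_compactRicciTestIdentity`) and the ramp/step limit lemma
(`helper_rampLimit`):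

* `helper_sublevelIdentity` — **`∫_{f<t} (2t − 3f + (1 + f − t) R) dV = 0`** for every level `t`
  (test function `(t − f)₊`);
* `helper_sublevelFlux_nonneg` — **`∫_{f<t} (2 − R) dV ≥ 0`**, i.e. `∫_{f<t} R dV ≤ 2 Vol{f<t}`
  (test function `1_{f<t}`, sign of the flux `∫_{f=t} |∇f| ≥ 0`);
* `helper_sublevelRicciIdentity` —
  **`∫_{f<t} [(t − f − 1) g⁻¹(dR, df) + (t − f)(R − 2|Ric|²)] dV = 0`** for every `t`;
* `helper_endSplit_nonneg` / `helper_coreSplit_nonpos` — the SIGNED core/end split of the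
  Wang–Wang identity: for a bounded `C¹` weight `η` with bounded derivative,
  `∫ e^{-f/τ} η(f) (f − 2τ + (τ − 1) R) dV = τ ∫ e^{-f/τ} η′(f) |∇f|² dV` has the sign of `η′`
  (`helper_firstOrderTestIdentity` and `|∇f|² = f − R ≥ 0`): non-negative on an END weight
  (`η′ ≥ 0`), non-positive on a CORE weight (`η′ ≤ 0`).

Everything here is proved; no definition and no named fact is introduced.

## References

* Y. Wang, G. Wang (Wang–Wang 2023), arXiv:2308.06560, Prop. 2.6, (2.7)–(2.10).
* H.-D. Cao, D. Zhou, *On complete gradient shrinking Ricci solitons*, JDG 85 (2010), §3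
  (the sublevel-set integration of `Δf = n/2 − R`).
* O. Munteanu, J. Wang, *Structure at infinity for shrinking Ricci solitons*, arXiv:1606.01861, §2.
-/

noncomputable section

-- `Summit.SmoothPoincare4.SmoothPoincare4.…` (summit = problem) trips `dupNamespace` on every decl.
set_option linter.dupNamespace false

open scoped Manifold ContDiff ENNReal NNReal Topology
open MeasureTheory Set Filter
open Literature.Geometry.Lorentzian Literature.Geometry.Riemannian

namespace Summit.SmoothPoincare4.SmoothPoincare4.Theorems.ConicalGapSketch

open CarrilloNi2009_shrinkerLSI

/-- **The sublevel-set identity** (registered helper `helper_sublevelIdentity` of line `Sketch`):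
on every complete connected normalised 4-d gradient shrinking Ricci soliton and for every level
`t`, the function `2t − 3f + (1 + f − t) R` is integrable on `{f < t}` and
`∫_{f<t} (2t − 3f + (1 + f − t) R) dV = 0`. It is the ramp limit (`helper_rampLimit`, test
functions `(t − f)₊`) of the first-order test-function identity
`∫ [η′(f)(f − R) + η(f)(2 − R)] dV = 0` (`helper_compactTestIdentity`):
`−(f − R) + (t − f)(2 − R) = 2t − 3f + (1 + f − t) R`. -/
theorem helper_sublevelIdentity : ∀ (M : Type) [TopologicalSpace M] [T2Space M] [SecondCountableTopology M] [ChartedSpace (EuclideanSpace ℝ (Fin 4)) M] [IsManifold (𝓡 4) ∞ M] [ConnectedSpace M] [T3Space M] [MeasurableSpace M] [BorelSpace M] (g : Literature.Geometry.Lorentzian.PseudoRiemannianMetric (𝓡 4) ∞ (EuclideanSpace ℝ (Fin 4)) (TangentSpace (𝓡 4) : M → Type _)) [g.HasLeviCivita] (f : M → ℝ) (hg : g.IsRiemannian), (∀ (x : M) (r : NNReal), IsCompact {y : M | g.edist hg x y ≤ r}) → ContMDiff (𝓡 4) 𝓘(ℝ, ℝ) ∞ f → (∀ (x : M) (X Y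 : TangentSpace (𝓡 4) x), g.ricci x X Y + g.hessian f x X Y = (1 / 2 : ℝ) * g.val x X Y) → (∀ x : M, g.scalarCurvature x + g.gradSq f x = f x) → ∀ t : ℝ, MeasureTheory.IntegrableOn (fun x ↦ 2 * t - 3 * f x + (1 + f x - t) * g.scalarCurvature x) {x | f x < t} (Literature.Geometry.Lorentzian.riemannianMeasure (g.toContMDiffRiemannianMetric hg)) ∧ ∫ x in {x | f x < t}, (2 * t - 3 * f x + (1 + f x - t) * g.scalarCurvature x) ∂(Literature.Geometry.Lorentzian.riemannianMeasure (g.toContMDiffRiemannianMetric hg)) = 0 := by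
  intro M _ _ _ _ _ _ _ _ _ g _ f hg hc hf hsol hnorm t
  obtain ⟨-, -, hprop⟩ :=
    NoncompactShrinkerGapCarrilloNiClauses.scalarCurvature_nonneg_and_isCompact_sublevel g f hg hc hf
      hsol hnorm
  haveI : LocallyCompactSpace M := Manifold.locallyCompact_of_finiteDimensional (M := M) (𝓡 4)
  haveI : IsFiniteMeasureOnCompacts (riemannianMeasure (g.toContMDiffRiemannianMetric hg)) := by
    have h := isFiniteMeasureOnCompacts_riemVolume hg
    rwa [PseudoRiemannianMetric.riemVolume_eq hg] at h
  have hRc : Continuous fun x ↦ g.scalarCurvature x :=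
    (PseudoRiemannianMetric.contMDiff_scalarCurvature g).continuous
  have hH : ∀ η : ℝ → ℝ, ContDiff ℝ 1 η → HasCompactSupport η →
      ∫ x, (deriv η (f x) * (f x - g.scalarCurvature x) + η (f x) * (2 - g.scalarCurvature x))
        ∂(riemannianMeasure (g.toContMDiffRiemannianMetric hg)) = 0 :=
    fun η hη hηc ↦ (helper_compactTestIdentity M g f hg hc hf hsol hnorm η hη hηc).2
  obtain ⟨⟨hint, hI⟩, -⟩ := helper_rampLimit M (riemannianMeasure (g.toContMDiffRiemannianMetric hg))
    f (fun x ↦ f x - g.scalarCurvature x) (fun x ↦ 2 - g.scalarCurvature x) hf.continuous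
    (hf.continuous.sub hRc) (continuous_const.sub hRc) hprop hH t
  have hmeas : MeasurableSet {x | f x < t} :=
    measurableSet_lt hf.continuous.measurable measurable_const
  have hpt : ∀ x, -(f x - g.scalarCurvature x) + (t - f x) * (2 - g.scalarCurvature x) =
      2 * t - 3 * f x + (1 + f x - t) * g.scalarCurvature x := fun x ↦ by ring
  refine ⟨hint.congr_fun (fun x _ ↦ hpt x) hmeas, ?_⟩
  rw [← hI]
  exact setIntegral_congr_fun hmeas fun x _ ↦ (hpt x).symm

/-- **The sublevel flux inequality** (registered helper `helper_sublevelFlux_nonneg` of line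
`Sketch`): on every complete connected normalised 4-d gradient shrinking Ricci soliton and for
every level `t`, `0 ≤ ∫_{f<t} (2 − R) dV`, i.e. `∫_{f<t} R dV ≤ 2 · Vol{f < t}` (formally the
flux `∫_{f=t} |∇f| dA ≥ 0` of `∇f` through the level set; here the step limit of
`helper_rampLimit` applied to `helper_compactTestIdentity`, using `f − R = |∇f|² ≥ 0`). -/
theorem helper_sublevelFlux_nonneg : ∀ (M : Type) [TopologicalSpace M] [T2Space M] [SecondCountableTopology M] [ChartedSpace (EuclideanSpace ℝ (Fin 4)) M] [IsManifold (𝓡 4) ∞ M] [ConnectedSpace M] [T3Space M] [MeasurableSpace M] [BorelSpace M] (g : Literature.Geometry.Lorentzian.PseudoRiemannianMetric (𝓡 4) ∞ (EuclideanSpace ℝ (Fin 4)) (TangentSpace (𝓡 4) : M → Type _)) [g.HasLeviCivita] (f : M → ℝ) (hg : g.IsRiemannian), (∀ (x : M) (r : NNReal), IsCompact {y : M | g.edist hg x y ≤ r}) → ContMDiff (𝓡 4) 𝓘(ℝ, ℝ) ∞ f → (∀ (x : M) (X Y : TangentSpace (𝓡 4) x), g.ricci x X Y + g.hessian f x X Y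 = (1 / 2 : ℝ) * g.val x X Y) → (∀ x : M, g.scalarCurvature x + g.gradSq f x = f x) → ∀ t : ℝ, 0 ≤ ∫ x in {x | f x < t}, (2 - g.scalarCurvature x) ∂(Literature.Geometry.Lorentzian.riemannianMeasure (g.toContMDiffRiemannianMetric hg)) := by
  intro M _ _ _ _ _ _ _ _ _ g _ f hg hc hf hsol hnorm t
  obtain ⟨-, -, hprop⟩ :=
    NoncompactShrinkerGapCarrilloNiClauses.scalarCurvature_nonneg_and_isCompact_sublevel g f hg hc hf
      hsol hnorm
  haveI : LocallyCompactSpace M := Manifold.locallyCompact_of_finiteDimensional (M := M) (𝓡 4)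
  haveI : IsFiniteMeasureOnCompacts (riemannianMeasure (g.toContMDiffRiemannianMetric hg)) := by
    have h := isFiniteMeasureOnCompacts_riemVolume hg
    rwa [PseudoRiemannianMetric.riemVolume_eq hg] at h
  have hRc : Continuous fun x ↦ g.scalarCurvature x :=
    (PseudoRiemannianMetric.contMDiff_scalarCurvature g).continuous
  have hH : ∀ η : ℝ → ℝ, ContDiff ℝ 1 η → HasCompactSupport η →
      ∫ x, (deriv η (f x) * (f x - g.scalarCurvature x) + η (f x) * (2 - g.scalarCurvature x))
        ∂(riemannianMeasure (g.toContMDiffRiemannianMetric hg)) = 0 :=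
    fun η hη hηc ↦ (helper_compactTestIdentity M g f hg hc hf hsol hnorm η hη hηc).2
  have hF0 : ∀ x, 0 ≤ f x - g.scalarCurvature x := fun x ↦ by
    have h1 := hnorm x
    have h2 := g.gradSq_nonneg hg f x
    linarith
  exact (helper_rampLimit M (riemannianMeasure (g.toContMDiffRiemannianMetric hg))
    f (fun x ↦ f x - g.scalarCurvature x) (fun x ↦ 2 - g.scalarCurvature x) hf.continuous
    (hf.continuous.sub hRc) (continuous_const.sub hRc) hprop hH t).2 hF0

/-- **The sublevel Ricci identity** (registered helper `helper_sublevelRicciIdentity` of line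
`Sketch`): on every complete connected normalised 4-d gradient shrinking Ricci soliton and for
every level `t`, the function `(t − f − 1) g⁻¹(dR, df) + (t − f)(R − 2|Ric|²)` is integrable on
`{f < t}` and `∫_{f<t} [(t − f − 1) g⁻¹(dR, df) + (t − f)(R − 2|Ric|²)] dV = 0` — the ramp limit
(`helper_rampLimit`) of the second-order test-function identity
`∫ [(η(f) + η′(f)) g⁻¹(dR, df) + η(f)(R − 2|Ric|²)] dV = 0` (`helper_compactRicciTestIdentity`,
i.e. Green's identity for `(t − f)₊` against Hamilton's `ΔR = g⁻¹(dR, df) + R − 2|Ric|²`). -/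
theorem helper_sublevelRicciIdentity : ∀ (M : Type) [TopologicalSpace M] [T2Space M] [SecondCountableTopology M] [ChartedSpace (EuclideanSpace ℝ (Fin 4)) M] [IsManifold (𝓡 4) ∞ M] [ConnectedSpace M] [T3Space M] [MeasurableSpace M] [BorelSpace M] (g : Literature.Geometry.Lorentzian.PseudoRiemannianMetric (𝓡 4) ∞ (EuclideanSpace ℝ (Fin 4)) (TangentSpace (𝓡 4) : M → Type _)) [g.HasLeviCivita] (f : M → ℝ) (hg : g.IsRiemannian), (∀ (x : M) (r : NNReal), IsCompact {y : M | g.edist hg x y ≤ r}) → ContMDiff (𝓡 4) 𝓘(ℝ, ℝ) ∞ f → (∀ (x : M) (X Y : TangentSpace (𝓡 4) x), g.ricci x X Y + g.hessian f x X Y = (1 / 2 : ℝ) * g.val x X Y) → (∀ x : M, g.scalarCurvature x + g.gradSq f x = f x) → ∀ t : ℝ, MeasureTheory.IntegrableOn (fun x ↦ (t - f x - 1) * g.innerDual x (mvfderiv (𝓡 4) g.scalarCurvature x).toLinearMap (mvfderiv (𝓡 4) f x).toLinearMap + (t - f x) * (g.scalarCurvature x - 2 * g.normSq x (g.ricci x)))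 {x | f x < t} (Literature.Geometry.Lorentzian.riemannianMeasure (g.toContMDiffRiemannianMetric hg)) ∧ ∫ x in {x | f x < t}, ((t - f x - 1) * g.innerDual x (mvfderiv (𝓡 4) g.scalarCurvature x).toLinearMap (mvfderiv (𝓡 4) f x).toLinearMap + (t - f x) * (g.scalarCurvature x - 2 * g.normSq x (g.ricci x))) ∂(Literature.Geometry.Lorentzian.riemannianMeasure (g.toContMDiffRiemannianMetric hg)) = 0 := by
  intro M _ _ _ _ _ _ _ _ _ g _ f hg hc hf hsol hnorm t
  obtain ⟨-, -, hprop⟩ :=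
    NoncompactShrinkerGapCarrilloNiClauses.scalarCurvature_nonneg_and_isCompact_sublevel g f hg hc hf
      hsol hnorm
  haveI : LocallyCompactSpace M := Manifold.locallyCompact_of_finiteDimensional (M := M) (𝓡 4)
  haveI : IsFiniteMeasureOnCompacts (riemannianMeasure (g.toContMDiffRiemannianMetric hg)) := by
    have h := isFiniteMeasureOnCompacts_riemVolume hg
    rwa [PseudoRiemannianMetric.riemVolume_eq hg] at h
  -- notation and continuity of the players
  set N : M → ℝ := fun x ↦ g.normSq x (g.ricci x) with hNdef
  set X : M → ℝ := fun x ↦ g.innerDual x (mvfderiv (𝓡 4) g.scalarCurvature x).toLinearMap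
    (mvfderiv (𝓡 4) f x).toLinearMap with hXdef
  have hNc : Continuous N := (g.contMDiff_normSq_ricci').continuous
  have hS1 : ContMDiff (𝓡 4) 𝓘(ℝ, ℝ) 1 g.scalarCurvature :=
    (PseudoRiemannianMetric.contMDiff_scalarCurvature g).of_le ENat.LEInfty.out
  have hf1 : ContMDiff (𝓡 4) 𝓘(ℝ, ℝ) 1 f := hf.of_le ENat.LEInfty.out
  have hXc : Continuous X := continuous_innerDual_mvfderiv g hS1 hf1
  have hRc : Continuous fun x ↦ g.scalarCurvature x :=
    (PseudoRiemannianMetric.contMDiff_scalarCurvature g).continuous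
  -- the family of test identities in the shape of `helper_rampLimit`
  have hH : ∀ η : ℝ → ℝ, ContDiff ℝ 1 η → HasCompactSupport η →
      ∫ x, (deriv η (f x) * X x + η (f x) * (X x + g.scalarCurvature x - 2 * N x))
        ∂(riemannianMeasure (g.toContMDiffRiemannianMetric hg)) = 0 := by
    intro η hη hηc
    have h := (helper_compactRicciTestIdentity M g f hg hc hf hsol hnorm η hη hηc).2
    rw [← h]
    exact integral_congr_ae (Eventually.of_forall fun x ↦ by simp only [hXdef, hNdef]; ring)
  obtain ⟨⟨hint, hI⟩, -⟩ := helper_rampLimit M (riemannianMeasure (g.toContMDiffRiemannianMetric hg))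
    f X (fun x ↦ X x + g.scalarCurvature x - 2 * N x) hf.continuous hXc
    ((hXc.add hRc).sub (continuous_const.mul hNc)) hprop hH t
  have hmeas : MeasurableSet {x | f x < t} :=
    measurableSet_lt hf.continuous.measurable measurable_const
  have hpt : ∀ x, -X x + (t - f x) * (X x + g.scalarCurvature x - 2 * N x) =
      (t - f x - 1) * X x + (t - f x) * (g.scalarCurvature x - 2 * N x) := fun x ↦ by ring
  refine ⟨hint.congr_fun (fun x _ ↦ hpt x) hmeas, ?_⟩
  rw [← hI]
  exact setIntegral_congr_fun hmeas fun x _ ↦ (hpt x).symm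

/-- **The END split of the Wang–Wang identity** (registered helper `helper_endSplit_nonneg` of
line `Sketch`): on every complete connected normalised 4-d gradient shrinking Ricci soliton, for a
`C¹` weight `η` with `|η|, |η′| ≤ C` and `η′ ≥ 0` (a smooth step from the core to the END) and
every `τ > 0`, `0 ≤ ∫ e^{-f/τ} η(f) (f − 2τ + (τ − 1) R) dV`: by `helper_firstOrderTestIdentity`
the integral equals `τ ∫ e^{-f/τ} η′(f) (f − R) dV`, and `f − R = |∇f|² ≥ 0`. (With `η ≡ 1`
both signs hold: Wang–Wang's identity.) -/
theorem helper_endSplit_nonneg : ∀ (M : Type) [TopologicalSpace M] [T2Space M] [SecondCountableTopology M] [ChartedSpace (EuclideanSpace ℝ (Fin 4)) M] [IsManifold (𝓡 4) ∞ M] [ConnectedSpace M] [T3Space M] [MeasurableSpace M] [BorelSpace M] (g : Literature.Geometry.Lorentzian.PseudoRiemannianMetric (𝓡 4) ∞ (EuclideanSpace ℝ (Fin 4)) (TangentSpace (𝓡 4) : M → Type _)) [g.HasLeviCivita] (f : M → ℝ) (hg : g.IsRiemannian), (∀ (x : M) (r : NNReal), IsCompact {y : M | g.edist hg x y ≤ r})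 → ContMDiff (𝓡 4) 𝓘(ℝ, ℝ) ∞ f → (∀ (x : M) (X Y : TangentSpace (𝓡 4) x), g.ricci x X Y + g.hessian f x X Y = (1 / 2 : ℝ) * g.val x X Y) → (∀ x : M, g.scalarCurvature x + g.gradSq f x = f x) → ∀ (η : ℝ → ℝ) (C : ℝ), ContDiff ℝ 1 η → (∀ r, |η r| ≤ C) → (∀ r, |deriv η r| ≤ C) → (∀ r, 0 ≤ deriv η r) → ∀ τ : ℝ, 0 < τ → 0 ≤ ∫ x, Real.exp (-f x / τ) * η (f x) * (f x - 2 * τ + (τ - 1) * g.scalarCurvature x) ∂(Literature.Geometry.Lorentzian.riemannianMeasure (g.toContMDiffRiemannianMetric hg)) := by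
  intro M _ _ _ _ _ _ _ _ _ g _ f hg hc hf hsol hnorm η C hη hb hb' hmono τ hτ
  obtain ⟨-, -, hI⟩ := helper_firstOrderTestIdentity M g f hg hc hf hsol hnorm η C hη hb hb' τ hτ
  rw [hI]
  refine mul_nonneg hτ.le (integral_nonneg fun x ↦ ?_)
  have h1 := hnorm x
  have h2 := g.gradSq_nonneg hg f x
  exact mul_nonneg (mul_nonneg (Real.exp_pos _).le (hmono _)) (by linarith)

/-- **The CORE split of the Wang–Wang identity** (registered helper `helper_coreSplit_nonpos` of
line `Sketch`): on every complete connected normalised 4-d gradient shrinking Ricci soliton, for a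
`C¹` weight `η` with `|η|, |η′| ≤ C` and `η′ ≤ 0` (a smooth step down from the CORE) and every
`τ > 0`, `∫ e^{-f/τ} η(f) (f − 2τ + (τ − 1) R) dV ≤ 0` (`helper_firstOrderTestIdentity` and
`f − R = |∇f|² ≥ 0`). In particular the core's `e^{-f/τ}`-mean of `f − 2τ + (τ − 1) R` is `≤ 0`
while the end's is `≥ 0` (`helper_endSplit_nonneg`). -/
theorem helper_coreSplit_nonpos : ∀ (M : Type) [TopologicalSpace M] [T2Space M] [SecondCountableTopology M] [ChartedSpace (EuclideanSpace ℝ (Fin 4)) M] [IsManifold (𝓡 4) ∞ M] [ConnectedSpace M] [T3Space M] [MeasurableSpace M] [BorelSpace M] (g : Literature.Geometry.Lorentzian.PseudoRiemannianMetric (𝓡 4) ∞ (EuclideanSpace ℝ (Fin 4)) (TangentSpace (𝓡 4) : M → Type _)) [g.HasLeviCivita] (f : M → ℝ) (hg : g.IsRiemannian), (∀ (x : M) (r : NNReal), IsCompact {y : M | g.edist hg x y ≤ r}) → ContMDiff (𝓡 4) 𝓘(ℝ, ℝ) ∞ f → (∀ (x : M) (X Y : TangentSpace (𝓡 4) x),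 g.ricci x X Y + g.hessian f x X Y = (1 / 2 : ℝ) * g.val x X Y) → (∀ x : M, g.scalarCurvature x + g.gradSq f x = f x) → ∀ (η : ℝ → ℝ) (C : ℝ), ContDiff ℝ 1 η → (∀ r, |η r| ≤ C) → (∀ r, |deriv η r| ≤ C) → (∀ r, deriv η r ≤ 0) → ∀ τ : ℝ, 0 < τ → ∫ x, Real.exp (-f x / τ) * η (f x) * (f x - 2 * τ + (τ - 1) * g.scalarCurvature x) ∂(Literature.Geometry.Lorentzian.riemannianMeasure (g.toContMDiffRiemannianMetric hg)) ≤ 0 := by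
  intro M _ _ _ _ _ _ _ _ _ g _ f hg hc hf hsol hnorm η C hη hb hb' hanti τ hτ
  obtain ⟨-, -, hI⟩ := helper_firstOrderTestIdentity M g f hg hc hf hsol hnorm η C hη hb hb' τ hτ
  rw [hI]
  refine mul_nonpos_of_nonneg_of_nonpos hτ.le (integral_nonpos fun x ↦ ?_)
  have h1 := hnorm x
  have h2 := g.gradSq_nonneg hg f x
  exact mul_nonpos_of_nonpos_of_nonneg
    (mul_nonpos_of_nonneg_of_nonpos (Real.exp_pos _).le (hanti _)) (by linarith)

end Summit.SmoothPoincare4.SmoothPoincare4.Theorems.ConicalGapSketch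

end
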